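import Mathlib.Analysis.Calculus.FDeriv.Add
import Mathlib.Analysis.Calculus.FDeriv.Mul
import Mathlib.Analysis.Calculus.FDeriv.Comp
import Mathlib.Analysis.Normed.Ring.Units
import Mathlib.Analysis.Normed.Operator.BoundedLinearMaps
import Mathlib.Topology.Algebra.Module.Equiv
import Mathlib.Topology.ContinuousMap.Bounded.Basic
import HarnessLib

/-!
# Derivatives of weighted averages and uniform invertibility near a compact slice

Topic `Topology/FourManifolds`; namespace `Literature.Topology.FourManifolds.BranchedModel`. Sixth
file of the proof of `Literature.Topology.FourManifolds.DegtyarevKharlamov2000_conjQuotient_unique`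
(`ConjugationQuotients.lean`): generic normed-space lemmas for the averaging step. Everything
is proved; no named facts.

* `hasFDerivAt_weightedSum` — the derivative of `x ↦ ∑ⱼ τⱼ(x) • Gⱼ(x)` is
  `∑ⱼ (τⱼ(w) • G'ⱼ + τ'ⱼ ⊗ Gⱼ(w))`; when `∑ⱼ τⱼ ≡ 1` the second sum may be recentred at any
  point `z` (`sum_smulRight_sub_eq`) and is then bounded by `(∑ⱼ ‖τ'ⱼ‖) · maxⱼ ‖Gⱼ(w) - z‖`
  (`norm_sum_smulRight_le`): weights with LARGE derivatives are harmless as long as the averaged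
  values are proportionally CLOSE — the mechanism of the logarithmic cutoff.
* `norm_sum_smul_comp_sub_le`, `norm_comp_sub_id_le` — the convex combination of
  `Pⱼ ∘ G'ⱼ` is close to that of the `G'ⱼ` when the `Pⱼ` are close to the identity, and
  `‖P ∘ Q - 1‖ ≤ ‖P - P₀‖ ‖Q‖` when `P₀ ∘ Q = 1` (retraction after embedding).
* `exists_uniform_inverse_bound` — a continuous family of operators on a compact parameter space,
  invertible on the zero set of a continuous nonnegative level function, is invertible with
  uniformly bounded inverse on a whole sublevel set `{lev ≤ s₁}`, `s₁ > 0` (units are open, the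
  inverse is continuous on units).
* `exists_continuousLinearEquiv_of_norm_sub_lt` — an operator within `C⁻¹` of an invertible one
  with `‖inverse‖ ≤ C` is invertible (`Units.ofNearby`), packaged as a `ContinuousLinearEquiv`
  for the inverse function theorem.

## References

* A. Degtyarev, V. Kharlamov, Russian Math. Surveys 55 (2000), arXiv:math/0004134, §3.2 ¶1.
  [DegtyarevKharlamov2000]
-/

noncomputable section

open scoped Topology
open Set Function Filter

namespace Literature.Topology.FourManifolds

namespace BranchedModel

section WeightedSum

variable {E F : Type*} [NormedAddCommGroup E] [NormedSpace ℝ E] [NormedAddCommGroup F]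
  [NormedSpace ℝ F] {ι : Type*}

/-- **The derivative of a weighted sum** `x ↦ ∑ⱼ τⱼ(x) • Gⱼ(x)`. [folklore] -/
theorem hasFDerivAt_weightedSum (s : Finset ι) {τ : ι → E → ℝ} {τ' : ι → E →L[ℝ] ℝ}
    {G : ι → E → F} {G' : ι → E →L[ℝ] F} {w : E}
    (hτ : ∀ j ∈ s, HasFDerivAt (τ j) (τ' j) w) (hG : ∀ j ∈ s, HasFDerivAt (G j) (G' j) w) :
    HasFDerivAt (fun x => ∑ j ∈ s, τ j x • G j x)
      (∑ j ∈ s, (τ j w • G' j + (τ' j).smulRight (G j w))) w :=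
  HasFDerivAt.fun_sum fun j hj => (hτ j hj).smul (hG j hj)

/-- **Recentring the weight-derivative term**: if the derivatives of the weights sum to zero
(the weights sum to one), `∑ⱼ τ'ⱼ ⊗ vⱼ = ∑ⱼ τ'ⱼ ⊗ (vⱼ - z)` for every `z`. [folklore] -/
theorem sum_smulRight_sub_eq (s : Finset ι) {τ' : ι → E →L[ℝ] ℝ} (v : ι → F) (z : F)
    (h0 : ∑ j ∈ s, τ' j = 0) :
    ∑ j ∈ s, (τ' j).smulRight (v j) = ∑ j ∈ s, (τ' j).smulRight (v j - z) := by
  have : ∑ j ∈ s, (τ' j).smulRight z = 0 := by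
    ext x
    simp only [FunLike.coe_sum, Finset.sum_apply, ContinuousLinearMap.smulRight_apply,
      zero_apply, ← Finset.sum_smul]
    have h0x : ∑ j ∈ s, τ' j x = 0 := by
      have := congrArg (fun A : E →L[ℝ] ℝ => A x) h0
      simpa using this
    rw [h0x, zero_smul]
  rw [← sub_zero (∑ j ∈ s, (τ' j).smulRight (v j)), ← this, ← Finset.sum_sub_distrib]
  refine Finset.sum_congr rfl fun j _ => ?_
  ext x
  simp [smul_sub]

/-- **Bound for the weight-derivative term**: `‖∑ⱼ τ'ⱼ ⊗ vⱼ‖ ≤ ∑ⱼ ‖τ'ⱼ‖ ‖vⱼ‖`. [folklore] -/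
theorem norm_sum_smulRight_le (s : Finset ι) (τ' : ι → E →L[ℝ] ℝ) (v : ι → F) :
    ‖∑ j ∈ s, (τ' j).smulRight (v j)‖ ≤ ∑ j ∈ s, ‖τ' j‖ * ‖v j‖ := by
  refine (norm_sum_le _ _).trans (Finset.sum_le_sum fun j _ => ?_)
  rw [ContinuousLinearMap.norm_smulRight_apply]

/-- With a uniform bound `‖vⱼ‖ ≤ d`: `‖∑ⱼ τ'ⱼ ⊗ vⱼ‖ ≤ (∑ⱼ ‖τ'ⱼ‖) d`. [folklore] -/
theorem norm_sum_smulRight_le_of_le (s : Finset ι) (τ' : ι → E →L[ℝ] ℝ) (v : ι → F) {d : ℝ}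
    (hv : ∀ j ∈ s, ‖v j‖ ≤ d) :
    ‖∑ j ∈ s, (τ' j).smulRight (v j)‖ ≤ (∑ j ∈ s, ‖τ' j‖) * d := by
  refine (norm_sum_smulRight_le s τ' v).trans ?_
  rw [Finset.sum_mul]
  exact Finset.sum_le_sum fun j hj => mul_le_mul_of_nonneg_left (hv j hj) (norm_nonneg _)

end WeightedSum

section Operators

variable {E F G : Type*} [NormedAddCommGroup E] [NormedSpace ℝ E] [NormedAddCommGroup F]
  [NormedSpace ℝ F] [NormedAddCommGroup G] [NormedSpace ℝ G] {ι : Type*}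

/-- **A convex combination of `Pⱼ ∘ Qⱼ` is close to that of the `Qⱼ` when the `Pⱼ` are close
to the identity**: with `tⱼ ≥ 0`, `∑ tⱼ = 1`, `‖Pⱼ - 1‖ ≤ a`, `‖Qⱼ‖ ≤ g`, the difference has
norm `≤ a g`. [folklore] -/
theorem norm_sum_smul_comp_sub_le (s : Finset ι) {t : ι → ℝ} (ht : ∀ j ∈ s, 0 ≤ t j)
    (ht1 : ∑ j ∈ s, t j = 1) (P : ι → F →L[ℝ] F) (Q : ι → E →L[ℝ] F) {a g : ℝ}
    (hP : ∀ j ∈ s, ‖P j - ContinuousLinearMap.id ℝ F‖ ≤ a) (hQ : ∀ j ∈ s, ‖Q j‖ ≤ g) :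
    ‖∑ j ∈ s, t j • (P j).comp (Q j) - ∑ j ∈ s, t j • Q j‖ ≤ a * g := by
  have hg : ∀ j ∈ s, 0 ≤ g := fun j hj => (norm_nonneg _).trans (hQ j hj)
  rw [← Finset.sum_sub_distrib]
  calc ‖∑ j ∈ s, (t j • (P j).comp (Q j) - t j • Q j)‖
      ≤ ∑ j ∈ s, ‖t j • (P j).comp (Q j) - t j • Q j‖ := norm_sum_le _ _
    _ ≤ ∑ j ∈ s, t j * (a * g) := by
      refine Finset.sum_le_sum fun j hj => ?_
      have : t j • (P j).comp (Q j) - t j • Q j = t j • ((P j - ContinuousLinearMap.id ℝ F).comp (Q j)) := by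
        rw [← smul_sub, ContinuousLinearMap.sub_comp, ContinuousLinearMap.id_comp]
      rw [this, norm_smul, Real.norm_eq_abs, abs_of_nonneg (ht j hj)]
      refine mul_le_mul_of_nonneg_left ?_ (ht j hj)
      exact (ContinuousLinearMap.opNorm_comp_le _ _).trans
        (mul_le_mul (hP j hj) (hQ j hj) (norm_nonneg _) ((norm_nonneg _).trans (hP j hj)))
    _ = a * g := by rw [← Finset.sum_mul, ht1, one_mul]

/-- **Retraction after embedding**: if `P₀ ∘ Q = 1` then `‖P ∘ Q - 1‖ ≤ ‖P - P₀‖ ‖Q‖`.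
[folklore] -/
theorem norm_comp_sub_id_le (P P₀ : F →L[ℝ] E) (Q : E →L[ℝ] F)
    (h : P₀.comp Q = ContinuousLinearMap.id ℝ E) :
    ‖P.comp Q - ContinuousLinearMap.id ℝ E‖ ≤ ‖P - P₀‖ * ‖Q‖ := by
  have : P.comp Q - ContinuousLinearMap.id ℝ E = (P - P₀).comp Q := by
    rw [ContinuousLinearMap.sub_comp, h]
  rw [this]
  exact ContinuousLinearMap.opNorm_comp_le _ _

/-- A convex combination of operators bounded by `g` is bounded by `g`. [folklore] -/
theorem norm_sum_smul_le (s : Finset ι) {t : ι → ℝ} (ht : ∀ j ∈ s, 0 ≤ t j)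
    (ht1 : ∑ j ∈ s, t j = 1) (Q : ι → E →L[ℝ] F) {g : ℝ} (hQ : ∀ j ∈ s, ‖Q j‖ ≤ g) :
    ‖∑ j ∈ s, t j • Q j‖ ≤ g := by
  calc ‖∑ j ∈ s, t j • Q j‖ ≤ ∑ j ∈ s, ‖t j • Q j‖ := norm_sum_le _ _
    _ ≤ ∑ j ∈ s, t j * g := Finset.sum_le_sum fun j hj => by
        rw [norm_smul, Real.norm_eq_abs, abs_of_nonneg (ht j hj)]
        exact mul_le_mul_of_nonneg_left (hQ j hj) (ht j hj)
    _ = g := by rw [← Finset.sum_mul, ht1, one_mul]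

end Operators

/-! ### Uniform invertibility near a compact slice -/

section Invertible

variable {E : Type*} [NormedAddCommGroup E] [NormedSpace ℝ E] [CompleteSpace E]

/-- **Uniform invertibility near the zero level.** Let `M : P → (E →L E)` be continuous on a
compact space `P` and invertible on the zero set of a continuous level function `lev ≥ 0`. Then
for some `s₁ > 0` and `C`, every `M p` with `lev p ≤ s₁` is a unit with `‖(M p)⁻¹‖ ≤ C` (units
form an open set on which inversion is continuous; compactness). [folklore] -/
theorem exists_uniform_inverse_bound {P : Type*} [TopologicalSpace P] [CompactSpace P]
    (M : P → E →L[ℝ] E) (hM : Continuous M) (lev : P → ℝ) (hlev : Continuous lev)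
    (hlev0 : ∀ p, 0 ≤ lev p) (hinv : ∀ p, lev p = 0 → IsUnit (M p)) :
    ∃ s₁ : ℝ, 0 < s₁ ∧ ∃ C : ℝ, 0 < C ∧ ∀ p, lev p ≤ s₁ →
      ∃ u : (E →L[ℝ] E)ˣ, (u : E →L[ℝ] E) = M p ∧ ‖((u⁻¹ : (E →L[ℝ] E)ˣ) : E →L[ℝ] E)‖ ≤ C := by
  -- the open set of good parameters and its closed complement
  set U : Set P := {p | IsUnit (M p)} with hU
  have hUopen : IsOpen U := Units.isOpen.preimage hM
  have hKc : IsCompact Uᶜ := hUopen.isClosed_compl.isCompact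
  -- a positive level separating the bad set from the zero level
  obtain ⟨s₁, hs₁, hsub⟩ : ∃ s₁ : ℝ, 0 < s₁ ∧ ∀ p, lev p ≤ s₁ → p ∈ U := by
    by_cases hne : (Uᶜ : Set P).Nonempty
    · obtain ⟨p₀, hp₀, hmin⟩ := hKc.exists_isMinOn hne hlev.continuousOn
      have hpos : 0 < lev p₀ := by
        rcases (hlev0 p₀).eq_or_lt with h0 | h0
        · exact absurd (hinv p₀ h0.symm) hp₀
        · exact h0
      refine ⟨lev p₀ / 2, by positivity, fun p hp => ?_⟩
      by_contra hbad
      have := hmin hbad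
      simp only [mem_setOf_eq] at this
      linarith
    · refine ⟨1, one_pos, fun p _ => ?_⟩
      by_contra hbad
      exact hne ⟨p, hbad⟩
  -- the inverse is continuous on the compact sublevel set
  have hKs : IsCompact {p : P | lev p ≤ s₁} := (isClosed_le hlev continuous_const).isCompact
  have hcont : ContinuousOn (fun p => Ring.inverse (M p)) {p : P | lev p ≤ s₁} := by
    intro p hp
    obtain ⟨u, hu⟩ := hsub p hp
    have h1 : ContinuousAt Ring.inverse (M p) := by
      rw [← hu]; exact NormedRing.inverse_continuousAt u
    exact (h1.comp hM.continuousAt).continuousWithinAt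
  obtain ⟨C₀, hC₀⟩ := hKs.exists_bound_of_continuousOn hcont
  refine ⟨s₁, hs₁, max C₀ 1, by positivity, fun p hp => ?_⟩
  obtain ⟨u, hu⟩ := hsub p hp
  refine ⟨u, hu, ?_⟩
  have := hC₀ p hp
  rw [← hu, Ring.inverse_unit] at this
  exact this.trans (le_max_left _ _)

/-- **Perturbation of an invertible operator**, packaged for the inverse function theorem: if
`u` is a unit with `‖u⁻¹‖ ≤ C` and `‖A - u‖ < C⁻¹` then `A` is (the coercion of) a continuous
linear equivalence. [folklore] -/
theorem exists_continuousLinearEquiv_of_norm_sub_lt (u : (E →L[ℝ] E)ˣ) {C : ℝ}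
    (hu : ‖((u⁻¹ : (E →L[ℝ] E)ˣ) : E →L[ℝ] E)‖ ≤ C) (A : E →L[ℝ] E)
    (hA : ‖A - (u : E →L[ℝ] E)‖ < C⁻¹) :
    ∃ e : E ≃L[ℝ] E, (e : E →L[ℝ] E) = A := by
  by_cases h0 : ‖((u⁻¹ : (E →L[ℝ] E)ˣ) : E →L[ℝ] E)‖ = 0
  · -- degenerate case: the operator ring is trivial
    have h1 : ((u⁻¹ : (E →L[ℝ] E)ˣ) : E →L[ℝ] E) = 0 := norm_eq_zero.1 h0
    have h2 : (0 : E →L[ℝ] E) = 1 := by rw [← u.mul_inv, h1, mul_zero]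
    haveI := subsingleton_of_zero_eq_one h2
    exact ⟨ContinuousLinearEquiv.unitsEquiv ℝ E u, Subsingleton.elim _ _⟩
  · have h : ‖A - (u : E →L[ℝ] E)‖ < ‖((u⁻¹ : (E →L[ℝ] E)ˣ) : E →L[ℝ] E)‖⁻¹ :=
      hA.trans_le (inv_anti₀ (lt_of_le_of_ne (norm_nonneg _) (Ne.symm h0)) hu)
    refine ⟨ContinuousLinearEquiv.unitsEquiv ℝ E (u.ofNearby A h), ?_⟩
    ext x
    rw [ContinuousLinearEquiv.coe_coe, ContinuousLinearEquiv.unitsEquiv_apply, Units.val_ofNearby]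

end Invertible

end BranchedModel

end Literature.Topology.FourManifolds

end
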